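import Mathlib
import HarnessLib
import Summits.KontsevichZagierPeriods.Zeta5Search.VWPSeriesSummable
import Summits.KontsevichZagierPeriods.Zeta5Search.VWPOfReal

/-!
# ζ(5) search — the typed `F_m` is an honest sum; residue bookkeeping for its Barnes integral (cell `pub-zeta5`, ct-1 g27)

HONEST FRAMING: systematic search; no irrationality claim unless kernel-certified.  Summability of the TYPED real series
`Zudilin2002.vwpSeries` and two algebraic identities; nothing here is an irrationality result, a worthiness exponent or a
denominator statement; no named fact is discharged; no definition is introduced.

* `summable_vwpSeries_terms` — under the real form of (5), `2 Σ_{j=1}^m h_j < (m−1)(1+h₀)`, with `h_j > 0`, `1 + h₀ − h_j > 0`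
  (`j ≤ m`), the terms of the typed `vwpSeries m h` are summable, so `vwpSeries m h` is their genuine sum (`hasSum_vwpSeries`)
  — the series-side twin of `SorokinConvergenceVWP.integrableOn_sorokinIntegrand_vwp` (from `VWPSeriesSummable.summable_vwpTerm` at
  `h ↦ (h n : ℂ)` and `Complex.summable_ofReal`).
* For B4 (`HOME/ct-1/g27/VWP-BLUEPRINT-g27.md` §2): `phase_parity` — `e^{iεπμ}(−1)^μ = (−1)^{(m+1)μ}` when `ε = 0` for even `m` and
  `ε = ±1` for odd `m` (the parity rule matching Zudilin's `e^{ε_k πis}`, `m = k+2`); `term_eq_regularPart` — the `μ`-th term of `F_m`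
  equals the regular part of the Barnes kernel at `s = μ` times `(−1)^{(m+1)μ}/μ!` (the `j = 0` denominator `Γ(1+h₀−h₀+μ) = μ!`
  is what the residue `Res_{s=μ} Γ(−s) = −(−1)^μ/μ!` supplies).

Theorems only; imports `Zeta5Search/VWPSeriesSummable`, `Zeta5Search/VWPOfReal`.
-/

noncomputable section

namespace Summit.KontsevichZagierPeriods.Zeta5Search.VWPSeriesTerms

open Finset
open scoped Real
open Literature.NumberTheory.Irrationality.Zudilin2002 (vwpSeries)
open Summit.KontsevichZagierPeriods.Zeta5Search.VWPSeriesSummable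

/-! ### 1. The typed series is an honest sum under (5) -/

/-- Termwise cast: the complex term at `h ↦ (h n : ℂ)` is the cast of the real term. -/
theorem term_ofReal (m : ℕ) (h : ℕ → ℝ) (μ : ℕ) :
    (((h 0 : ℝ) : ℂ) + 2 * μ) *
        (∏ j ∈ range (m + 1), Complex.Gamma (((h j : ℝ) : ℂ) + μ) / Complex.Gamma (1 + ((h 0 : ℝ) : ℂ) - ((h j : ℝ) : ℂ) + μ)) *
        (-1 : ℂ) ^ ((m + 1) * μ) =
      (((h 0 + 2 * μ) * (∏ j ∈ range (m + 1), Real.Gamma (h j + μ) / Real.Gamma (1 + h 0 - h j + μ)) *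
        (-1 : ℝ) ^ ((m + 1) * μ) : ℝ) : ℂ) := by
  have hΓ : ∀ r : ℝ, ((Real.Gamma r : ℝ) : ℂ) = Complex.Gamma (r : ℂ) := fun r => (Complex.Gamma_ofReal r).symm
  push_cast
  simp_rw [hΓ]
  push_cast
  rfl

/-- **The typed `vwpSeries m h` is an honest sum under (5)** [Zudilin math/0206177, Remark after (7)]: for real `h` with `h_j > 0`,
`1 + h₀ − h_j > 0` (`j ≤ m`) and `2 Σ_{j=1}^m h_j < (m−1)(1+h₀)`, the terms of `Zudilin2002.vwpSeries m h` are summable. -/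
theorem summable_vwpSeries_terms (m : ℕ) (h : ℕ → ℝ) (hpos : ∀ j, j ≤ m → 0 < h j) (hden : ∀ j, j ≤ m → 0 < 1 + h 0 - h j)
    (h5 : 2 * (∑ j ∈ range m, h (j + 1)) < ((m : ℝ) - 1) * (1 + h 0)) :
    Summable fun μ : ℕ => (h 0 + 2 * μ) * (∏ j ∈ range (m + 1), Real.Gamma (h j + μ) / Real.Gamma (1 + h 0 - h j + μ)) *
      (-1 : ℝ) ^ ((m + 1) * μ) := by
  have hc := summable_vwpTerm m (fun n => (h n : ℂ)) (fun j hj => by simpa using hpos j hj)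
    (fun j hj => by simpa using hden j hj) (by simpa using h5)
  rw [← Complex.summable_ofReal]
  refine hc.congr fun μ => ?_
  exact term_ofReal m h μ

/-- Hence `vwpSeries m h` is the `HasSum`-value of its terms. -/
theorem hasSum_vwpSeries (m : ℕ) (h : ℕ → ℝ) (hpos : ∀ j, j ≤ m → 0 < h j) (hden : ∀ j, j ≤ m → 0 < 1 + h 0 - h j)
    (h5 : 2 * (∑ j ∈ range m, h (j + 1)) < ((m : ℝ) - 1) * (1 + h 0)) :
    HasSum (fun μ : ℕ => (h 0 + 2 * μ) * (∏ j ∈ range (m + 1), Real.Gamma (h j + μ) / Real.Gamma (1 + h 0 - h j + μ)) *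
      (-1 : ℝ) ^ ((m + 1) * μ)) (vwpSeries m h) := by
  rw [vwpSeries]
  exact (summable_vwpSeries_terms m h hpos hden h5).hasSum

/-! ### 2. Residue bookkeeping for the Barnes integral of `F_m` -/

/-- **The parity rule**: for `μ : ℕ`, `e^{iεπμ}(−1)^μ = (−1)^{(m+1)μ}` when `ε = 0` and `m` is even, or `ε = ±1` and `m` is odd. -/
theorem phase_parity {m : ℕ} {ε : ℝ} (hε : (Even m ∧ ε = 0) ∨ (Odd m ∧ (ε = 1 ∨ ε = -1))) (μ : ℕ) :
    Complex.exp (ε * π * Complex.I * μ) * (-1 : ℂ) ^ μ = (-1 : ℂ) ^ ((m + 1) * μ) := by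
  rcases hε with ⟨hm, rfl⟩ | ⟨hm, hε⟩
  · obtain ⟨r, rfl⟩ := hm
    simp only [Complex.ofReal_zero, zero_mul, Complex.exp_zero, one_mul]
    rw [show (r + r + 1) * μ = μ + 2 * (r * μ) by ring, pow_add, pow_mul]
    simp
  · obtain ⟨r, rfl⟩ := hm
    have hexp : Complex.exp (ε * π * Complex.I * μ) = (-1 : ℂ) ^ μ := by
      rcases hε with rfl | rfl
      · rw [← Complex.exp_pi_mul_I, ← Complex.exp_nat_mul]; push_cast; ring_nf
      · rw [show ((-1 : ℝ) : ℂ) * π * Complex.I * μ = -(μ * (π * Complex.I)) by push_cast; ring, Complex.exp_neg,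
          Complex.exp_nat_mul, Complex.exp_pi_mul_I, ← inv_pow, inv_neg_one]
    rw [hexp, ← pow_add, show μ + μ = 2 * μ by ring, show (2 * r + 1 + 1) * μ = 2 * ((r + 1) * μ) by ring, pow_mul, pow_mul]
    simp

/-- **The term as the regular part of the kernel at `s = μ`**: separating the `j = 0` denominator `Γ(1+h₀−h₀+μ) = Γ(μ+1) = μ!`,
`(h₀+2μ) ∏_{j≤m} Γ(h_j+μ)/Γ(1+h₀−h_j+μ) = [(h₀+2μ) ∏_{j≤m}Γ(h_j+μ) / ∏_{j<m}Γ(1+h₀−h_{j+1}+μ)] / μ!`. -/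
theorem term_eq_regularPart (m : ℕ) (h : ℕ → ℂ) (μ : ℕ) :
    (h 0 + 2 * μ) * (∏ j ∈ range (m + 1), Complex.Gamma (h j + μ) / Complex.Gamma (1 + h 0 - h j + μ)) =
      (h 0 + 2 * μ) * (∏ j ∈ range (m + 1), Complex.Gamma (h j + μ)) /
          (∏ j ∈ range m, Complex.Gamma (1 + h 0 - h (j + 1) + μ)) / (μ.factorial : ℂ) := by
  rw [prod_div_distrib, prod_range_succ' (fun j => Complex.Gamma (1 + h 0 - h j + μ))]
  have h0 : Complex.Gamma (1 + h 0 - h 0 + (μ : ℂ)) = (μ.factorial : ℂ) := by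
    rw [add_sub_cancel_right, add_comm, Complex.Gamma_nat_eq_factorial]
  rw [h0]
  ring

end Summit.KontsevichZagierPeriods.Zeta5Search.VWPSeriesTerms

end
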